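import Summits.ABC.ABC.Theses.IneffectiveSubspace
import Summits.ABC.ABC.Theorems.IneffectiveSubspaceUniformSadicGivesTowerFour
import Summits.ABC.ABC.Theorems.TowerFourSubLiouville.Negative.DialCalibration
import Summits.ABC.ABC.Theorems.TowerFourSubLiouville.Negative.LogLoss

/-!
# `UniformSadicTowerFour` (stmt-ABC-14937): `ε` cannot be dropped, already at `K = 0`

Negative-side tightness lemmas of the standing disprover (cycle 1, refuter-cdisprove-stmt-ABC-14937-0,
2026-08-16).  The `K = 0`, `S = ∅` face of the crux is Vojta's level-4 tower inequality with exponent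
`1` (landed as `UniformSadicTowerFour.MixedRadical.towerIneqFourOne_of_uniformSadicTowerFour` in
`Theorems/IneffectiveSubspaceUniformSadicTowerFourNormalForm.lean`; the bracket of `M ≠ 0` at `S = ∅`
is `M`, `UniformSadicGivesTowerFour.bracket_empty`), so the Pell–Matiyasevich family of the sibling disprover
(`TowerFourSubLiouville.Negative.DialCalibration.not_towerIneq4OneNoEps`: `u² − 3v² = 1`, `y_N² ∣ y_{N y_N}`,
`c/M ≥ N/3`) shows that the crux with exponent exactly `1` — constants `C(K)` and no `ε` — is false
(`uniformSadicTowerFour_false_without_eps`), and even a loss `(log c)^A` with `A < 1` fails at `K = 0`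
(`uniformSadicTowerFour_false_logLoss`, from `Negative.LogLoss.not_towerIneq4One_logLoss`).
So `Literature.Barriers.ABC.EpsilonCannotBeDropped` is respected by force, not by caution: any proof of
the crux must lose `c^ε` (more than `(log c)^{1−δ}`) at the `K = 0` face.  All statements inlined.
-/

-- `Summit.<Summit>.<Problem>` is the mandated summit-side namespace (CONVENTIONS §2); for the
-- single-conjunct summit `ABC` the two coincide, so the duplicate `ABC.ABC` is deliberate.
set_option linter.dupNamespace false

namespace Summit.ABC.ABC.Theorems.UniformSadicTowerFour.Negative

open scoped BigOperators
open Summit.ABC.ABC.Theses.IneffectiveSubspace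
open Summit.ABC.ABC.Theorems
open Summit.ABC.ABC.Theorems.TowerFourSubLiouville.Negative

/-- **`ε = 0` is false.** There are no constants `C(K)` with `c < C(K)·bracket` (exponent exactly `1`):
at `K = 0`, `S = ∅` the bracket is `M = ∏ xᵢyᵢzᵢ`, and `Negative.DialCalibration.not_towerIneq4OneNoEps`
(Pell `u² − 3v² = 1` with Matiyasevich's `y_N² ∣ y_{N y_N}`: `c/M ≥ N/3`) refutes `c < C·M`. -/
theorem uniformSadicTowerFour_false_without_eps :
    ¬ ∀ K : ℕ, ∃ C : ℝ, 0 < C ∧ ∀ S : Finset ℕ, S.card ≤ K → (∀ p ∈ S, Nat.Prime p) →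
      ∀ x y z : Fin 4 → ℕ, (∀ i, 0 < x i ∧ 0 < y i ∧ 0 < z i) →
      (∏ i, x i ^ (i.val + 1)) + (∏ i, y i ^ (i.val + 1)) = ∏ i, z i ^ (i.val + 1) →
      Nat.Coprime (∏ i, x i ^ (i.val + 1)) (∏ i, y i ^ (i.val + 1)) →
      ((∏ i, z i ^ (i.val + 1) : ℕ) : ℝ) < C * (((∏ p ∈ S, p) *
        ∏ p ∈ (∏ i, x i * y i * z i).primeFactors \ S, p ^ (∏ i, x i * y i * z i).factorization p : ℕ) :
          ℝ) := by
  intro h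
  obtain ⟨C, hC, hK⟩ := h 0
  refine not_towerIneq4OneNoEps ⟨C, hC, fun x y z hpos hsum hcop => ?_⟩
  have hM : (∏ i, x i * y i * z i) ≠ 0 :=
    (Finset.prod_pos fun i _ =>
      Nat.mul_pos (Nat.mul_pos (hpos i).1 (hpos i).2.1) (hpos i).2.2).ne'
  have key := hK ∅ (by simp) (by simp) x y z hpos hsum hcop
  rwa [Summit.ABC.ABC.Theorems.UniformSadicGivesTowerFour.bracket_empty hM] at key

/-- **Even a logarithmic loss fails at `K = 0`.** For every `A < 1` there is no `C` with
`c ≤ C·bracket·(log c)^A` at `S = ∅` (from `Negative.LogLoss.not_towerIneq4One_logLoss`). -/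
theorem uniformSadicTowerFour_false_logLoss (A : ℝ) (hA : A < 1) :
    ¬ ∃ C : ℝ, ∀ x y z : Fin 4 → ℕ, (∀ i, 0 < x i ∧ 0 < y i ∧ 0 < z i) →
      (∏ i, x i ^ (i.val + 1)) + (∏ i, y i ^ (i.val + 1)) = ∏ i, z i ^ (i.val + 1) →
      Nat.Coprime (∏ i, x i ^ (i.val + 1)) (∏ i, y i ^ (i.val + 1)) →
      ((∏ i, z i ^ (i.val + 1) : ℕ) : ℝ) ≤ C * (((∏ p ∈ (∅ : Finset ℕ), p) *
        ∏ p ∈ (∏ i, x i * y i * z i).primeFactors \ ∅, p ^ (∏ i, x i * y i * z i).factorization p : ℕ) :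
          ℝ) * Real.log (((∏ i, z i ^ (i.val + 1) : ℕ) : ℝ)) ^ A := by
  rintro ⟨C, h⟩
  refine not_towerIneq4One_logLoss A hA ⟨C, fun x y z hpos hsum hcop => ?_⟩
  have hM : (∏ i, x i * y i * z i) ≠ 0 :=
    (Finset.prod_pos fun i _ =>
      Nat.mul_pos (Nat.mul_pos (hpos i).1 (hpos i).2.1) (hpos i).2.2).ne'
  have key := h x y z hpos hsum hcop
  rwa [Summit.ABC.ABC.Theorems.UniformSadicGivesTowerFour.bracket_empty hM] at key

end Summit.ABC.ABC.Theorems.UniformSadicTowerFour.Negative
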